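import Literature.Computability.Cryptography.ObfuscatedGluedTrees

/-!
# `WbwObfuscatedGluedTrees` (stmt-QuantumAdvantage-2340) — line `knowledge-of-walk-split`, STAGE 3,
# toolkit `NbrBitFP`, piece G1b: un-naming (SIV decryption of vertex names) is polynomial time on codes

The specification-level recogniser `unname P μ k₁ k₂ d y` of
`Literature/Computability/Cryptography/ObfuscatedGluedTrees.lean` is defined by classical choice over the
finite vertex set.  This file proves that the map
`(1^μ, k₁, k₂, 1^d, y) ↦ true :: label d v` (if `unname … y = some v`) `/ []` (otherwise) is `CodeFP`
(computed on codes by an `FP` string function), given the PRF evaluation map on codes.  The witness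
is the honest DECISION PROCEDURE of SIV decryption: split `y = τ ++ c` (`|τ| = μ`), unmask
`x = c ⊕ F_{k₂}(τ)`, check that `x` is a well-formed label (length `2d+3`, depth field `j ≤ d`,
position field `i < 2^j`) and that re-encryption gives back `y` (`sivEnc x = y`, which subsumes the
tag check); it agrees with `unname` by `unname_eq_some_iff` / `unname_eq_none_iff`.

[folklore] (closure of polynomial time, AroraBarak2009 §1.3; SIV decryption by recomputation,
Goldreich2004FoC2 Construction 5.4.19).
-/

set_option linter.dupNamespace false

noncomputable section

namespace Summit.QuantumAdvantage.QuantumAdvantage.Theorems.WbwObfuscatedGluedTrees.KnowledgeOfWalk.Generator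

open Literature.Computability.Cryptography Literature.Computability.Complexity
  Literature.Computability.Cryptography.ObfuscatedGluedTrees Literature.Computability.QuantumComplexity
open Literature.Computability.Complexity.CodeFP

/-! ## §1 Labels: binary fields and the well-formedness test -/

/-- Reading the bits of `⟦l⟧` back gives `l`: `bitsOf |l| ⟦l⟧ = l`. [folklore] -/
private theorem bitsOf_bitsToNat {w : ℕ} {l : List Bool} (h : l.length = w) : bitsOf w (bitsToNat l) = l := by
  subst h
  refine List.ext_getElem (by simp) fun t h₁ h₂ => ?_
  simp only [bitsOf, List.getElem_ofFn, Com.testBit_bitsToNat, List.getD_eq_getElem?_getD,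
    List.getElem?_eq_getElem h₂, Option.getD_some]

/-- `⟦bitsOf w m⟧ = m` for `m < 2^w`. [folklore] -/
private theorem bitsToNat_bitsOf {w m : ℕ} (hm : m < 2 ^ w) : bitsToNat (bitsOf w m) = m :=
  bitsOf_injOn w (by simpa using bitsToNat_lt (bitsOf w m)) hm (bitsOf_bitsToNat (length_bitsOf w m))

/-- **The label test**: a string is the label of a vertex of `G'_d` iff it has length `2d+3`, its depth
field `j = ⟦x[1..d+1]⟧` is `≤ d` and its position field `i = ⟦x[d+2..]⟧` is `< 2^j`. [folklore] -/
private theorem labelTest_iff (d : ℕ) (x : List Bool) :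
    (decide (x.length = 2 * d + 3) && (decide (bitsToNat ((x.drop 1).take (d + 1)) ≤ d) &&
      decide (bitsToNat (x.drop (d + 2)) < 2 ^ min (bitsToNat ((x.drop 1).take (d + 1))) d))) = true ↔
    ∃ v, label d v = x := by
  simp only [Bool.and_eq_true, decide_eq_true_eq]
  constructor
  · rintro ⟨hl, hj, hi⟩
    obtain ⟨s, r, rfl⟩ : ∃ s r, x = s :: r := by
      cases x with
      | nil => simp at hl
      | cons s r => exact ⟨s, r, rfl⟩
    simp only [List.length_cons, List.drop_succ_cons, List.drop_zero] at hl hj hi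
    rw [min_eq_left hj] at hi
    have hJ : (r.take (d + 1)).length = d + 1 := by rw [List.length_take]; omega
    have hI : (r.drop (d + 1)).length = d + 1 := by rw [List.length_drop]; omega
    refine ⟨(s, ⟨⟨bitsToNat (r.take (d + 1)), Nat.lt_succ_of_le hj⟩, ⟨bitsToNat (r.drop (d + 1)), hi⟩⟩), ?_⟩
    change s :: (bitsOf (d + 1) (bitsToNat (r.take (d + 1))) ++ bitsOf (d + 1) (bitsToNat (r.drop (d + 1)))) = _
    rw [bitsOf_bitsToNat hJ, bitsOf_bitsToNat hI, List.take_append_drop]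
  · rintro ⟨⟨s, j, i⟩, rfl⟩
    have hj : (j : ℕ) ≤ d := Nat.le_of_lt_succ j.isLt
    have hA : (bitsOf (d + 1) (j : ℕ)).length = d + 1 := length_bitsOf _ _
    have e1 : ((label d (s, ⟨j, i⟩)).drop 1).take (d + 1) = bitsOf (d + 1) j := by
      change (bitsOf (d + 1) (j : ℕ) ++ bitsOf (d + 1) (i : ℕ)).take (d + 1) = _
      rw [List.take_left' hA]
    have e2 : (label d (s, ⟨j, i⟩)).drop (d + 2) = bitsOf (d + 1) i := by
      change (bitsOf (d + 1) (j : ℕ) ++ bitsOf (d + 1) (i : ℕ)).drop (d + 1) = _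
      rw [List.drop_left' hA]
    rw [e1, e2, bitsToNat_bitsOf (j.isLt.trans Nat.lt_two_pow_self), min_eq_left hj,
      bitsToNat_bitsOf (lt_of_lt_of_le i.isLt (Nat.pow_le_pow_right two_pos (by omega)))]
    exact ⟨length_label _, hj, i.isLt⟩

/-! ## §2 The decision procedure agrees with `unname` -/

/-- Un-masking an honest name with the recomputed mask returns the label. [folklore] -/
private theorem bxor_vname_eq (P : PuncturablePRFScheme) (μ : ℕ) (k₁ k₂ : List Bool) (d : ℕ)
    (v : GluedTrees.Vertex d) :
    bxor ((vname P μ k₁ k₂ d v).drop μ) (prf P μ k₂ (2 * d + 3) ((vname P μ k₁ k₂ d v).take μ)) =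
      label d v := by
  have hl : (label d v).length = 2 * d + 3 := length_label v
  rw [vname, sivEnc, List.drop_left' (length_tag P μ k₁ _), List.take_left' (length_tag P μ k₁ _), hl]
  exact bxor_bxor_of_length_eq (by rw [length_prf, hl])

/-- **Correctness of SIV decryption against the specification `unname`**: for a candidate label
`F y` that IS the label whenever `y` is an honest name, accepting iff `F y` is a well-formed label
(`b`) and re-encrypts to `y` (`c`) outputs `true :: label v` on `name v` and `[]` on every other
string. [folklore] -/
private theorem dec_eq_of {P : PuncturablePRFScheme} {μ d : ℕ} {k₁ k₂ y : List Bool} {b c : Bool}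
    (F : List Bool → List Bool) (hb : b = true ↔ ∃ v, label d v = F y)
    (hc : c = true ↔ sivEnc P μ k₁ k₂ (F y) = y) (hF : ∀ v, F (vname P μ k₁ k₂ d v) = label d v) :
    (if b && c then true :: F y else []) =
      ((unname P μ k₁ k₂ d y).map fun v => true :: label d v).getD [] := by
  cases h : unname P μ k₁ k₂ d y with
  | none =>
    rw [Option.map_none, Option.getD_none, if_neg]
    rw [Bool.and_eq_true, hb, hc]
    rintro ⟨⟨v, hv⟩, hy⟩
    exact (unname_eq_none_iff P μ k₁ k₂ d y).1 h v (by rw [vname, hv]; exact hy)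
  | some v =>
    have hy := (unname_eq_some_iff P μ k₁ k₂ d y v).1 h
    have hx : F y = label d v := by rw [← hy]; exact hF v
    rw [Option.map_some, Option.getD_some, if_pos, hx]
    rw [Bool.and_eq_true, hb, hc, hx]
    exact ⟨⟨v, rfl⟩, hy⟩

/-! ## §3 The pieces on codes -/

section Codes

variable {P : PuncturablePRFScheme}

/-- `(1^μ, k, 1^m, x) ↦ prf P μ k m x` from the PRF evaluation map (as `FPData.prfFP`). [folklore] -/
private theorem prfCodeFP (hP : CodeFP (pairE unE (pairE strE strE)) strE
      (fun p : ℕ × List Bool × List Bool => P.eval p.1 p.2.1 p.2.2)) :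
    CodeFP (pairE unE (pairE strE (pairE unE strE))) strE (fun p => prf P p.1 p.2.1 p.2.2.1 p.2.2.2) := by
  have pμ : CodeFP (pairE unE (pairE strE (pairE unE strE))) unE (fun p => p.1) := fst _ _
  have pk : CodeFP (pairE unE (pairE strE (pairE unE strE))) strE (fun p => p.2.1) := (snd _ _).fst'
  have pm : CodeFP (pairE unE (pairE strE (pairE unE strE))) unE (fun p => p.2.2.1) := (snd _ _).snd'.fst'
  have px : CodeFP (pairE unE (pairE strE (pairE unE strE))) strE (fun p => p.2.2.2) := (snd _ _).snd'.snd'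
  have hev : CodeFP (pairE unE (pairE strE (pairE unE strE))) strE
      (fun p => P.eval p.1 p.2.1 (fit p.1 p.2.2.2)) :=
    hP.comp (pμ.pair (pk.pair (FPData.fitFP.comp (pμ.pair px))))
  exact (FPData.fitFP.comp (pm.pair hev)).congr fun _ => rfl

/-- Bitwise xor of two strings on codes (`zipWith` over the exploded bit lists). [folklore] -/
private theorem bxorCodeFP : CodeFP (pairE strE strE) strE (fun p => bxor p.1 p.2) := by
  have hz := zipWith (σ := Unit) (eσ := unitE) (g := fun t : Unit × Bool × Bool => (t.2.1 ^^ t.2.2))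
    (xorBit.comp (snd _ _))
  exact (bitsToStr.comp (hz.comp ((const _ ()).pair ((MachineA.explode_code.comp (fst _ _)).pair
    (MachineA.explode_code.comp (snd _ _)))))).congr fun _ => rfl

/-- `((1^μ, k₁, k₂), x) ↦ sivEnc P μ k₁ k₂ x` on codes. [folklore] -/
private theorem sivEncCodeFP (hP : CodeFP (pairE unE (pairE strE strE)) strE
      (fun p : ℕ × List Bool × List Bool => P.eval p.1 p.2.1 p.2.2)) :
    CodeFP (pairE (pairE unE (pairE strE strE)) strE) strE
      (fun q : (ℕ × List Bool × List Bool) × List Bool => sivEnc P q.1.1 q.1.2.1 q.1.2.2 q.2) := by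
  let E : (ℕ × List Bool × List Bool) × List Bool → List Bool := pairE (pairE unE (pairE strE strE)) strE
  have qμ : CodeFP E unE (fun q => q.1.1) := (fst _ _).fst'
  have q₁ : CodeFP E strE (fun q => q.1.2.1) := (fst _ _).snd'.fst'
  have q₂ : CodeFP E strE (fun q => q.1.2.2) := (fst _ _).snd'.snd'
  have qx : CodeFP E strE (fun q => q.2) := snd _ _
  have htag : CodeFP E strE (fun q => tag P q.1.1 q.1.2.1 q.2) :=
    ((prfCodeFP hP).comp (qμ.pair (q₁.pair (qμ.pair qx)))).congr fun _ => rfl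
  have hmask : CodeFP E strE (fun q => prf P q.1.1 q.1.2.2 q.2.length (tag P q.1.1 q.1.2.1 q.2)) :=
    (prfCodeFP hP).comp (qμ.pair (q₂.pair ((strLength.comp qx).pair htag)))
  exact (strAppend.comp (htag.pair (bxorCodeFP.comp (qx.pair hmask)))).congr fun _ => rfl

/-- `1^d ↦ 1^{2d+3}`. [folklore] -/
private theorem labelLenCodeFP : CodeFP unE unE (fun d => 2 * d + 3) :=
  (unSucc.comp (unSucc.comp (unSucc.comp (unMulConst 2)))).congr fun _ => rfl

/-- The label test of `labelTest_iff` on codes `(1^d, x)` (no exponential: the exponent is the unary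
`min j d`). [folklore] -/
private theorem labelTestCodeFP : CodeFP (pairE unE strE) bitE (fun q : ℕ × List Bool =>
    decide (q.2.length = 2 * q.1 + 3) && (decide (bitsToNat ((q.2.drop 1).take (q.1 + 1)) ≤ q.1) &&
      decide (bitsToNat (q.2.drop (q.1 + 2)) < 2 ^ min (bitsToNat ((q.2.drop 1).take (q.1 + 1))) q.1))) := by
  have qd : CodeFP (pairE unE strE) unE (fun q => q.1) := fst _ _
  have qx : CodeFP (pairE unE strE) strE (fun q => q.2) := snd _ _
  have hj : CodeFP (pairE unE strE) natE (fun q => bitsToNat ((q.2.drop 1).take (q.1 + 1))) :=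
    strVal.comp (strTake.comp ((unSucc.comp qd).pair (strDrop.comp ((const _ (1 : ℕ)).pair qx))))
  have hi : CodeFP (pairE unE strE) natE (fun q => bitsToNat (q.2.drop (q.1 + 2))) :=
    strVal.comp (strDrop.comp ((unSucc.comp (unSucc.comp qd)).pair qx))
  have hlen : CodeFP (pairE unE strE) bitE (fun q => decide (q.2.length = 2 * q.1 + 3)) :=
    (CodeFP.eq unE_injective).comp ((strLength.comp qx).pair (labelLenCodeFP.comp qd))
  have hpow : CodeFP (pairE unE strE) natE (fun q => 2 ^ min (bitsToNat ((q.2.drop 1).take (q.1 + 1))) q.1) :=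
    natPow.comp ((const _ (2 : ℕ)).pair (unOfNatMin.comp (qd.pair hj)))
  exact hlen.and ((natLeUn.comp (hj.pair qd)).and (natLt.comp (hi.pair hpow)))

end Codes

/-! ## §4 The registered statement -/

/-- **Un-naming is polynomial time on codes** (piece G1b of `NbrBitFP`): given the PRF evaluation map on
codes, `(1^μ, k₁, k₂, 1^d, y) ↦ true :: label d v` if `unname P μ k₁ k₂ d y = some v`, `[]` otherwise,
is `CodeFP` — by the SIV decision procedure (unmask with `F_{k₂}(τ)`, test well-formedness of the label,
re-encrypt and compare), which agrees with the classical `unname` (`dec_eq_of`). [folklore] -/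
theorem toolkit_unname :
    ∀ (P : PuncturablePRFScheme),
      Literature.Computability.Complexity.CodeFP (pairE unE (pairE strE strE)) strE
        (fun p : ℕ × List Bool × List Bool => P.eval p.1 p.2.1 p.2.2) →
      Literature.Computability.Complexity.CodeFP (pairE unE (pairE strE (pairE strE (pairE unE strE)))) strE
        (fun t : ℕ × List Bool × List Bool × ℕ × List Bool =>
          ((unname P t.1 t.2.1 t.2.2.1 t.2.2.2.1 t.2.2.2.2).map fun v => true :: label t.2.2.2.1 v).getD []) := by
  intro P hP
  let E : ℕ × List Bool × List Bool × ℕ × List Bool → List Bool :=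
    pairE unE (pairE strE (pairE strE (pairE unE strE)))
  have pμ : CodeFP E unE (fun t => t.1) := fst _ _
  have p₁ : CodeFP E strE (fun t => t.2.1) := (snd _ _).fst'
  have p₂ : CodeFP E strE (fun t => t.2.2.1) := (snd _ _).snd'.fst'
  have pd : CodeFP E unE (fun t => t.2.2.2.1) := (snd _ _).snd'.snd'.fst'
  have py : CodeFP E strE (fun t => t.2.2.2.2) := (snd _ _).snd'.snd'.snd'
  -- the candidate label `x = (y ⇂ μ) ⊕ F_{k₂}(y ↾ μ)` fitted to `2d+3` bits
  have hx : CodeFP E strE (fun t => bxor (t.2.2.2.2.drop t.1)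
      (prf P t.1 t.2.2.1 (2 * t.2.2.2.1 + 3) (t.2.2.2.2.take t.1))) :=
    bxorCodeFP.comp ((strDrop.comp (pμ.pair py)).pair
      ((prfCodeFP hP).comp (pμ.pair (p₂.pair ((labelLenCodeFP.comp pd).pair (strTake.comp (pμ.pair py)))))))
  -- the two tests and the output
  have hb := labelTestCodeFP.comp (pd.pair hx)
  have hc := (CodeFP.eq (eα := strE) fun _ _ h => h).comp
    (((sivEncCodeFP hP).comp ((pμ.pair (p₁.pair p₂)).pair hx)).pair py)
  have hout := consBit.comp ((const E true).pair hx)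
  refine ((hb.and hc).ite hout (const E ([] : List Bool))).congr fun t => ?_
  exact dec_eq_of (fun y => bxor (y.drop t.1) (prf P t.1 t.2.2.1 (2 * t.2.2.2.1 + 3) (y.take t.1)))
    (labelTest_iff _ _) decide_eq_true_iff fun v => bxor_vname_eq P _ _ _ _ v

end Summit.QuantumAdvantage.QuantumAdvantage.Theorems.WbwObfuscatedGluedTrees.KnowledgeOfWalk.Generator

end
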